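import Summits.AnomalousDissipation.AnomalousDissipation.Theorems.SawtoothPulseCascadePlanarForce
import Literature.Analysis.FluidPDE.DEIJDriftRegularity

/-!
# `ConstructionRegular` for the sawtooth pulse cascade on the route's box (K3loc line `DriftFree`,
# stub S1 `stub_packaging`, conjunct (a))

Route `AnomalousDissipation/SawtoothPulseCascade`, crux K3loc (stmt-AnomalousDissipation-19492), registered
line `DriftFree` v3 (`Cruxes.K3LocalisedClosure.DriftFree`).  Its stub S1 `stub_packaging` is the conjunction
of `∀ box, DriftFree.ConstructionRegular P` and `∀ box, DriftFree.Existence P`; this file PROVES the first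
conjunct verbatim (`constructionRegular58`), indeed `ConstructionRegular P` for every parameter set with
`0 < δ₀`, `0 < d`, `1 ≤ N₀`, `2 ≤ ρN` (`constructionRegular`):

1. the lifted datum `(0, 0, sin 2πx₁) ∘ π` is smooth (`Cascade.isSmooth_liftedDatum`);
2. the lifted force `(∂ₜū, 0) ∘ π` is jointly smooth on `[0,1) × 𝕋³` (`Cascade.isSmoothSpaceTimeOn_liftedForce`:
   the tree's `SawtoothCascade.cascadeFieldSmooth`, then `Torus.IsSmoothSpaceTimeOn.timeDerivWithin` and
   `.twoHalf`);
3. for every `α < 1` the force is bounded and continuous in `C^{0,α}(𝕋³)` on the CLOSED interval `[0, 1]`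
   (`Cascade.continuousInHolderOn_liftedForce`; the uniform bound then follows from compactness,
   `ContinuousInHolderOn.holderUniformlyBoundedOn_holds`).  On `[0,1)` this is joint smoothness
   (`Torus.DEIJ.continuousInHolderOn_Ico_of_isSmoothSpaceTimeOn`); AT `t = 1` it is the design property of
   the schedule: on phase `j` the force is a shear drift of amplitude `|rate′| ≤ |γ| sup|bump′| / tHalf_j²`
   (`tHalf_j = 45/(π⁴(j+1)⁴)`) and profile `U_j` with `|U_j| ≤ 1/(4N_j) ≤ 2^{-j}`, `|U_j′| ≤ 1`, so by the
   interpolation bound `Torus.DEIJ.eBoundedHolderNorm_drift_le`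
   `‖f(t)‖_{C^{0,α}} ≤ 12 (|γ| sup|bump′| / tHalf_j²) 2^{−(1−α) j} ≍ (j+1)⁸ 2^{−(1−α)j} → 0`
   (`Cascade.eBoundedHolderNorm_liftedForce_le`, `Cascade.tendsto_sliceBound`) — the force is Hölder up to
   the singular time but not Lipschitz (Brué–De Lellis Question 2.1's regularity class).

No new definitions, no named facts; the second conjunct `Existence` (2D global classical forced Navier–Stokes
on `[0,1)` plus packaging) is NOT addressed here.
-/

-- `Summit.<Summit>.<Problem>` is the tree's mandated summit-side namespace (CONVENTIONS §2); for this
-- single-conjunct summit the two coincide, so the duplicate is deliberate (lakefile: off for `Summits`).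
set_option linter.dupNamespace false

noncomputable section

open MeasureTheory Set Filter Topology
open scoped NNReal ENNReal ContDiff
open Literature.Analysis Literature.Analysis.FunctionSpaces Literature.Analysis.FluidPDE
open Literature.Analysis.FluidPDE.SawtoothCascade
open Literature.Analysis.FluidPDE.SawtoothCascade.DriftFree
open Literature.Analysis.FunctionSpaces.Torus (twoHalf planarProj)

namespace Summit.AnomalousDissipation.AnomalousDissipation.Theorems

/-! ## Hölder norms of the lifted force, slice by slice, and their decay as `t → 1` -/

namespace Cascade

open CascadeParams

variable (P : CascadeParams)

/-- Elementary interpolation arithmetic: for `0 ≤ β`, `0 < A ≤ 1`, `0 ≤ r ≤ 1`,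
`βA + (3√3 β)^r (2βA)^{1−r} ≤ 12 β A^{1−r}`. -/
theorem interp_le {β A r : ℝ} (hβ : 0 ≤ β) (hA0 : 0 < A) (hA1 : A ≤ 1) (hr0 : 0 ≤ r) (hr1 : r ≤ 1) :
    β * A + (Real.sqrt 3 * (3 * (β * 1))) ^ r * (2 * (β * A)) ^ (1 - r) ≤ 12 * (β * A ^ (1 - r)) := by
  have h3 : Real.sqrt 3 ≤ 7 / 4 := by
    rw [show (7 / 4 : ℝ) = Real.sqrt ((7 / 4) ^ 2) by rw [Real.sqrt_sq (by norm_num)]]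
    exact Real.sqrt_le_sqrt (by norm_num)
  have h3' : 1 ≤ Real.sqrt 3 := by
    rw [← Real.sqrt_one]
    exact Real.sqrt_le_sqrt (by norm_num)
  have hAr : A ≤ A ^ (1 - r) := by
    have := Real.rpow_le_rpow_of_exponent_ge hA0 hA1 (by linarith : 1 - r ≤ 1)
    rwa [Real.rpow_one] at this
  have hArnn : 0 ≤ A ^ (1 - r) := Real.rpow_nonneg hA0.le _
  have h1 : β * A ≤ β * A ^ (1 - r) := mul_le_mul_of_nonneg_left hAr hβ
  have hc0 : 0 ≤ Real.sqrt 3 * 3 := by positivity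
  have hr1' : r + (1 - r) = 1 := by ring
  have hββ : β ^ r * β ^ (1 - r) = β := by
    rw [← Real.rpow_add' hβ (by rw [hr1']; norm_num), hr1', Real.rpow_one]
  have h2 : (Real.sqrt 3 * (3 * (β * 1))) ^ r * (2 * (β * A)) ^ (1 - r) =
      ((Real.sqrt 3 * 3) ^ r * (2 : ℝ) ^ (1 - r)) * (β * A ^ (1 - r)) := by
    rw [show Real.sqrt 3 * (3 * (β * 1)) = (Real.sqrt 3 * 3) * β by ring,
      show 2 * (β * A) = 2 * β * A by ring,
      Real.mul_rpow hc0 hβ, Real.mul_rpow (by positivity) hA0.le, Real.mul_rpow (by norm_num) hβ]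
    calc (Real.sqrt 3 * 3) ^ r * β ^ r * ((2 : ℝ) ^ (1 - r) * β ^ (1 - r) * A ^ (1 - r))
        = (Real.sqrt 3 * 3) ^ r * (2 : ℝ) ^ (1 - r) * (β ^ r * β ^ (1 - r)) * A ^ (1 - r) := by ring
      _ = (Real.sqrt 3 * 3) ^ r * (2 : ℝ) ^ (1 - r) * (β * A ^ (1 - r)) := by rw [hββ]; ring
  have hK1 : (Real.sqrt 3 * 3) ^ r ≤ Real.sqrt 3 * 3 := by
    have := Real.rpow_le_rpow_of_exponent_le (by nlinarith : 1 ≤ Real.sqrt 3 * 3) hr1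
    rwa [Real.rpow_one] at this
  have hK2 : (2 : ℝ) ^ (1 - r) ≤ 2 := by
    have := Real.rpow_le_rpow_of_exponent_le (by norm_num : (1 : ℝ) ≤ 2) (by linarith : 1 - r ≤ 1)
    rwa [Real.rpow_one] at this
  have hK : (Real.sqrt 3 * 3) ^ r * (2 : ℝ) ^ (1 - r) ≤ 11 := by
    calc (Real.sqrt 3 * 3) ^ r * (2 : ℝ) ^ (1 - r) ≤ (Real.sqrt 3 * 3) * 2 :=
          mul_le_mul hK1 hK2 (Real.rpow_nonneg (by norm_num) _) hc0
      _ ≤ 11 := by nlinarith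
  have hβA : 0 ≤ β * A ^ (1 - r) := mul_nonneg hβ hArnn
  rw [h2]
  nlinarith

/-- `N_j ≥ 2^j` when `N₀ ≥ 1` and `ρN ≥ 2`. -/
theorem two_pow_le_N (hN₀ : 1 ≤ P.N₀) (hρ : 2 ≤ P.ρN) (j : ℕ) : (2 : ℝ) ^ j ≤ P.N j := by
  have h : P.N j = P.N₀ * P.ρN ^ j := rfl
  rw [h]
  push_cast
  calc (2 : ℝ) ^ j = 1 * 2 ^ j := (one_mul _).symm
    _ ≤ (P.N₀ : ℝ) * (P.ρN : ℝ) ^ j :=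
        mul_le_mul (by exact_mod_cast hN₀) (pow_le_pow_left₀ (by norm_num) (by exact_mod_cast hρ) j)
          (by positivity) (by positivity)

/-- **Slice bound.** On phase `j` (either half-slot), for `r ≤ 1`:
`‖f(t)‖_{C^{0,r}} ≤ 12 · (|γ| M / tHalf_j²) · ((1/2)^{1−r})^j`, where `|bump′| ≤ M`. -/
theorem eBoundedHolderNorm_liftedForce_le {M : ℝ} (hM : ∀ s, |deriv CascadeParams.bump s| ≤ M)
    (hδ₀ : 0 < P.δ₀) (hd : 0 < P.d) (hN₀ : 1 ≤ P.N₀) (hρ : 2 ≤ P.ρN) {r : ℝ≥0} (hr : r ≤ 1)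
    {j : ℕ} {t : ℝ} (ht : t ∈ Icc (tStart j) (tStart (j + 1))) :
    eBoundedHolderNorm r (liftedForce P t) ≤
      ENNReal.ofReal (12 * ((|P.γ| * M / tHalf j ^ 2) * (((1 / 2 : ℝ) ^ (1 - (r : ℝ))) ^ j))) := by
  have hδ := P.δ_pos hδ₀ hd j
  have hN := P.N_pos hN₀ (le_trans one_le_two hρ) j
  have hN' : (0 : ℝ) < P.N j := by exact_mod_cast hN
  have hM0 : 0 ≤ M := (abs_nonneg _).trans (hM 0)
  have hB0 : 0 ≤ |P.γ| * M / tHalf j ^ 2 := by have := tHalf_pos j; positivity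
  set A : ℝ := 1 / (4 * (P.N j : ℝ)) with hA
  have hA0 : 0 < A := by positivity
  have hNj := two_pow_le_N P hN₀ hρ j
  have h1N : (1 : ℝ) ≤ P.N j := le_trans (one_le_pow₀ (by norm_num : (1 : ℝ) ≤ 2)) hNj
  have hA1 : A ≤ 1 := by
    rw [hA, div_le_iff₀ (by positivity)]
    linarith
  have hAq : A ≤ (1 / 2 : ℝ) ^ j := by
    rw [hA, one_div_pow]
    exact one_div_le_one_div_of_le (by positivity) (by linarith)
  have hr' : (r : ℝ) ≤ 1 := by exact_mod_cast hr
  have h1r : 0 ≤ 1 - (r : ℝ) := by linarith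
  have hAr : A ^ (1 - (r : ℝ)) ≤ ((1 / 2 : ℝ) ^ j) ^ (1 - (r : ℝ)) := Real.rpow_le_rpow hA0.le hAq h1r
  have hUA : ∀ s, |(⟨P.U j, P.U_periodic j, P.contDiff_U hδ⟩ : Torus.ShearProfile) s| ≤ A :=
    fun s => abs_U_le P hδ hN s
  have hUB : ∀ s, |deriv (⟨P.U j, P.U_periodic j, P.contDiff_U hδ⟩ : Torus.ShearProfile) s| ≤ 1 :=
    fun s => P.abs_deriv_U_le_one hδ s
  have key : ∀ b : ℝ, |b| ≤ |P.γ| * M / tHalf j ^ 2 → ∀ p q : Fin 3,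
      eBoundedHolderNorm r (Torus.DEIJ.drift p q ⟨P.U j, P.U_periodic j, P.contDiff_U hδ⟩ b) ≤
        ENNReal.ofReal (12 * ((|P.γ| * M / tHalf j ^ 2) * (((1 / 2 : ℝ) ^ (1 - (r : ℝ))) ^ j))) := by
    intro b hb p q
    refine (Torus.DEIJ.eBoundedHolderNorm_drift_le p q hUA hUB b hr).trans (ENNReal.ofReal_le_ofReal ?_)
    simp only [Fintype.card_fin, Nat.cast_ofNat]
    refine (interp_le (abs_nonneg b) hA0 hA1 r.2 hr').trans ?_
    rw [Real.rpow_pow_comm (by norm_num : (0 : ℝ) ≤ 1 / 2)]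
    exact mul_le_mul_of_nonneg_left (mul_le_mul hb hAr (Real.rpow_nonneg hA0.le _) hB0) (by norm_num)
  rcases le_or_gt t (tStart j + tHalf j) with h | h
  · rw [liftedForce_of_mem_H P hδ ⟨ht.1, h⟩]
    exact key _ (SawtoothPulseCascade.DriftFreeClosure.Rates.abs_deriv_rateH_le P hM j t) 0 1
  · rw [liftedForce_of_mem_V P hδ ⟨h.le, ht.2⟩]
    exact key _ (SawtoothPulseCascade.DriftFreeClosure.Rates.abs_deriv_rateV_le P hM j t) 1 0

/-- The slice bounds tend to `0` along the phases: `(j+1)⁸ q^j → 0` for `0 < q < 1`. -/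
theorem tendsto_sliceBound {C q : ℝ} (hq0 : 0 < q) (hq1 : q < 1) :
    Tendsto (fun j : ℕ => 12 * ((C / tHalf j ^ 2) * q ^ j)) atTop (𝓝 0) := by
  have h := tendsto_pow_const_mul_const_pow_of_abs_lt_one 8 (show |q| < 1 by rwa [abs_of_pos hq0])
  have h' : Tendsto (fun j : ℕ => (((j + 1 : ℕ) : ℝ)) ^ 8 * q ^ (j + 1)) atTop (𝓝 0) :=
    (tendsto_add_atTop_iff_nat 1).2 h
  have h'' := h'.const_mul (12 * C * Real.pi ^ 8 / 2025 / q)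
  rw [mul_zero] at h''
  refine h''.congr fun j => ?_
  have hq : q ≠ 0 := hq0.ne'
  have hj : ((j : ℝ) + 1) ≠ 0 := by positivity
  simp only [tHalf]
  push_cast
  field_simp
  ring

/-- Every `t ∈ [0, 1)` lies in some phase: `tStart j ≤ t < tStart (j+1)`. -/
theorem exists_phase {t : ℝ} (ht0 : 0 ≤ t) (ht1 : t < 1) : ∃ j, tStart j ≤ t ∧ t < tStart (j + 1) := by
  classical
  have hex : ∃ m, t < tStart m := ((tendsto_order.1 tendsto_tStart).1 t ht1).exists
  have hm : t < tStart (Nat.find hex) := Nat.find_spec hex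
  have hm0 : Nat.find hex ≠ 0 := by
    intro h
    rw [h] at hm
    exact absurd hm (not_lt.2 (by simpa [tStart] using ht0))
  obtain ⟨j, hj⟩ := Nat.exists_eq_succ_of_ne_zero hm0
  refine ⟨j, ?_, by rw [hj] at hm; exact hm⟩
  by_contra h
  exact Nat.find_min hex (by rw [hj]; exact Nat.lt_succ_self j) (not_le.1 h)

/-! ## Smoothness of the explicit data -/

/-- The scalar datum `sin 2πx₁` is smooth on `𝕋²`. -/
theorem isSmooth_datum : Torus.IsSmooth datum := by
  have hper : Function.Periodic (fun s : ℝ => Real.sin (2 * Real.pi * s)) 1 := fun s => by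
    simp [mul_add, Real.sin_add_two_pi]
  have h : Torus.lift datum = fun y : EuclideanSpace ℝ (Fin 2) => Real.sin (2 * Real.pi * y 0) := by
    funext y
    exact Torus.lift_coordFun_apply hper 0 y
  unfold Torus.IsSmooth
  rw [h]
  exact Real.contDiff_sin.comp (contDiff_const.mul (contDiff_euclidean.1 contDiff_id 0))

/-- The lifted datum `(0, 0, sin 2πx₁) ∘ π` is smooth on `𝕋³`. -/
theorem isSmooth_liftedDatum : Torus.IsSmooth liftedDatum :=
  Torus.IsSmooth.twoHalf (Torus.isSmooth_const (0 : EuclideanSpace ℝ (Fin 2))) isSmooth_datum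

/-- The planar force `∂ₜū` is jointly smooth on `[0, 1) × 𝕋²`. -/
theorem isSmoothSpaceTimeOn_planarForce (hδ₀ : 0 < P.δ₀) (hd : 0 < P.d) :
    Torus.IsSmoothSpaceTimeOn (Ico 0 1) (planarForce P) := by
  have h := Torus.IsSmoothSpaceTimeOn.timeDerivWithin (cascadeFieldSmooth P hδ₀ hd) (uniqueDiffOn_Ico (0 : ℝ) 1)
  refine (h : ContDiffOn ℝ ∞ _ _).congr fun z hz => ?_
  have hz1 : z.1 < 1 := (mem_prod.1 hz).1.2
  show planarForce P z.1 (Torus.proj z.2) = Torus.timeDerivWithin (Ico 0 1) P.field z.1 (Torus.proj z.2)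
  rw [planarForce, if_pos hz1]

/-- The lifted force `(∂ₜū, 0) ∘ π` is jointly smooth on `[0, 1) × 𝕋³`. -/
theorem isSmoothSpaceTimeOn_liftedForce (hδ₀ : 0 < P.δ₀) (hd : 0 < P.d) :
    Torus.IsSmoothSpaceTimeOn (Ico 0 1) (liftedForce P) :=
  Torus.IsSmoothSpaceTimeOn.twoHalf (isSmoothSpaceTimeOn_planarForce P hδ₀ hd)
    (Torus.isSmoothSpaceTimeOn_const (Torus.isSmooth_const (0 : ℝ)) _)

/-! ## Continuity in every Hölder norm `C^{0,r}`, `r < 1`, up to and including `t = 1` -/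

/-- **The lifted force is continuous on `[0, 1]` with values in `C^{0,r}(𝕋³)`, for every `r < 1`** —
on `[0, 1)` by joint smoothness, at `t = 1` because its `C^{0,r}` norm on phase `j` is
`≲ (j+1)⁸ 2^{−(1−r)j} → 0` (the design property of the `tHalf`/`N_j` schedule). -/
theorem continuousInHolderOn_liftedForce (hδ₀ : 0 < P.δ₀) (hd : 0 < P.d) (hN₀ : 1 ≤ P.N₀) (hρ : 2 ≤ P.ρN)
    {r : ℝ≥0} (hr : r < 1) : ContinuousInHolderOn (Icc 0 1) r (liftedForce P) := by
  have hIco := Torus.DEIJ.continuousInHolderOn_Ico_of_isSmoothSpaceTimeOn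
    (isSmoothSpaceTimeOn_liftedForce P hδ₀ hd) hr
  obtain ⟨M, hM0, hM⟩ := SawtoothPulseCascade.DriftFreeClosure.exists_abs_deriv_bump_le
  refine ⟨fun t ht => ?_, fun t₀ ht₀ => ?_⟩
  · rcases lt_or_ge t 1 with h | h
    · exact hIco.1 t ⟨ht.1, h⟩
    · rw [liftedForce_of_one_le P h]
      exact memBoundedHolder_zero
  · rcases lt_or_ge t₀ 1 with h | h
    · have hlim := hIco.2 t₀ ⟨ht₀.1, h⟩
      have hmem : Ico (0 : ℝ) 1 ∈ 𝓝[Icc 0 1] t₀ := by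
        filter_upwards [inter_mem_nhdsWithin (Icc (0 : ℝ) 1) (Iio_mem_nhds h)] with t ht
        exact ⟨ht.1.1, ht.2⟩
      exact hlim.mono_left (nhdsWithin_le_of_mem hmem)
    · obtain rfl : t₀ = 1 := le_antisymm ht₀.2 h
      rw [liftedForce_of_one_le P le_rfl]
      simp only [sub_zero]
      -- the slice bounds along the phases
      set q : ℝ := (1 / 2 : ℝ) ^ (1 - (r : ℝ)) with hq
      have hr' : (r : ℝ) < 1 := by exact_mod_cast hr
      have hq0 : 0 < q := Real.rpow_pos_of_pos (by norm_num) _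
      have hq1 : q < 1 := Real.rpow_lt_one (by norm_num) (by norm_num) (by linarith)
      have hE := ENNReal.tendsto_ofReal (tendsto_sliceBound (C := |P.γ| * M) hq0 hq1)
      rw [ENNReal.ofReal_zero] at hE
      refine tendsto_order.2 ⟨fun a ha => absurd ha ENNReal.not_lt_zero, fun ε hε => ?_⟩
      obtain ⟨J, hJ⟩ := eventually_atTop.1 (hE.eventually (gt_mem_nhds hε))
      filter_upwards [inter_mem_nhdsWithin (Icc (0 : ℝ) 1) (Ioi_mem_nhds (tStart_lt_one J))] with t ht
      rcases lt_or_ge t 1 with h1 | h1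
      · obtain ⟨j, hj, hj'⟩ := exists_phase ht.1.1 h1
        have hJj : J ≤ j := by
          by_contra hlt
          exact absurd ((tStart_mono (Nat.succ_le_of_lt (not_le.1 hlt))).trans_lt ht.2) (not_lt.2 hj'.le)
        exact (eBoundedHolderNorm_liftedForce_le P hM hδ₀ hd hN₀ hρ hr.le ⟨hj, hj'.le⟩).trans_lt (hJ j hJj)
      · rw [liftedForce_of_one_le P h1, eBoundedHolderNorm_zero]
        exact hε

end Cascade

/-! ## The regularity package `ConstructionRegular` -/

/-- **`ConstructionRegular P` holds** for every parameter set with `0 < δ₀`, `0 < d`, `1 ≤ N₀`, `2 ≤ ρN`: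
smooth datum, force jointly smooth on `[0,1) × 𝕋³`, and bounded and continuous in every Hölder norm
`C^α`, `α < 1`, on `[0, 1]` (the uniform bound from norm-continuity on the compact interval,
`ContinuousInHolderOn.holderUniformlyBoundedOn_holds`). -/
theorem constructionRegular (P : CascadeParams) (hδ₀ : 0 < P.δ₀) (hd : 0 < P.d) (hN₀ : 1 ≤ P.N₀)
    (hρ : 2 ≤ P.ρN) : ConstructionRegular P := by
  refine ⟨Cascade.isSmooth_liftedDatum, Cascade.isSmoothSpaceTimeOn_liftedForce P hδ₀ hd, fun α hα => ?_⟩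
  have hc := Cascade.continuousInHolderOn_liftedForce P hδ₀ hd hN₀ hρ hα
  have hub : HolderUniformlyBoundedOn (Icc 0 1) α (liftedForce P) :=
    ContinuousInHolderOn.holderUniformlyBoundedOn_holds hc isCompact_Icc
  exact ⟨⟨⨆ t ∈ Icc (0 : ℝ) 1, eBoundedHolderNorm α (liftedForce P t), hub, fun t ht =>
    le_iSup₂ (f := fun t (_ : t ∈ Icc (0 : ℝ) 1) => eBoundedHolderNorm α (liftedForce P t)) t ht⟩, hc⟩

/-- **STUB S1(a) `stub_regularity` of the registered K3loc line `DriftFree`** (stmt-AnomalousDissipation-19492),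
verbatim: `ConstructionRegular` on the route's box `γ ∈ [5, 8]`, `ρN ∈ {2, …, 7}` (`δ₀ = ¼`, `d = 2`, `N₀ = 1`). -/
theorem stub_regularity : ∀ γ ∈ Icc (5 : ℝ) 8, ∀ ρN ∈ Finset.Icc 2 7, ConstructionRegular ⟨γ, 1 / 4, 2, 1, ρN⟩ :=
  fun _ _ _ hρN => constructionRegular _ (by norm_num) (by norm_num) le_rfl (Finset.mem_Icc.1 hρN).1

/-- `ConstructionRegular` on the route's box, with the parameter point spelled as in the route items
(`⟨γ, 1/4, 2, 1, ρN⟩ : CascadeParams`); alias of `stub_regularity`. -/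
theorem constructionRegular58 :
    ∀ γ ∈ Icc (5 : ℝ) 8, ∀ ρN ∈ Finset.Icc 2 7, ConstructionRegular (⟨γ, 1 / 4, 2, 1, ρN⟩ : CascadeParams) :=
  stub_regularity

end Summit.AnomalousDissipation.AnomalousDissipation.Theorems

end
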